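import Summits.AnomalousDissipation.AnomalousDissipation.Theorems.IsotropicCubatureWord
import HarnessLib

/-!
# K2R `RealisedQuasiStaticCellLaw`, line `floquet-bloch`, stub `stub_lowSectorDecay` (S1D): elementary arithmetic of the
# weak-coupling roads — slaving weights from the gap data, the min-polarisation gain of the cubature word, decay-form monotonicity

Summits-side helper file (everything proved; no definitions, no named facts; `--supports stmt-AnomalousDissipation-20446`).
(1) `slaving_weight_bounds`: from the gap data of `anySlot_inputs` (`d₀ ≤ 1/16`, `d_{±1} ≥ d₀ + 7/16`, `d_{±1} ≤ 2`) and links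
`|s| ≤ 1`: `σ_o = 1/(d₋₁−d₀) + 1/(d₁−d₀) ∈ [1, 32/7]`, `σ_i = s₋₁²/(d₋₁−d₀) + s₀²/(d₁−d₀) ∈ [γ²/2, 16γ²/7]`, `γ² = s₀² + s₋₁² ≤ 2`
— the inputs `hβo/hβi/hσole/hσile` of `weakSector_decay_ae` / `isoSector_decay_ae`.
(2) `minPol_slotTerm_sum`: the slot sum of the IN-PLANE (minimal-polarisation) gains of the cubature word is isotropic and equal
to ONE THIRD of the isotropic gain: `Σ_j (slotTerm_j(q,0) − slotTerm_j(q,q)) = (1/3)·c0·3720·|q|⁴` (from `slotTerm_sum`) — whence the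
min-polarisation road covers every shell `|ℓ′|² ≥ 4` and only `|ℓ′|² ≤ 3` needs the isotropic composition.
(3) `decay_form_mono`: `C₁e^{−r₁t}X ≤ C₂e^{−r₂t}X` for `C₁ ≤ C₂`, `r₂ ≤ r₁`, `t, X, C₂ ≥ 0`.
-/

set_option linter.dupNamespace false

noncomputable section

namespace Summit.AnomalousDissipation.AnomalousDissipation.Theorems.SolenoidalFractalHomogenisation.RealisedQuasiStaticCellLaw

open Real

/-- **Slaving weights from the gap data.** -/
theorem slaving_weight_bounds {d0 d1 dm1 s0 sm1 : ℝ} (hd0 : 0 ≤ d0) (h1 : d0 + 7 / 16 ≤ d1) (hm1 : d0 + 7 / 16 ≤ dm1)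
    (h1' : d1 ≤ 2) (hm1' : dm1 ≤ 2) (hs0 : |s0| ≤ 1) (hsm1 : |sm1| ≤ 1) :
    1 ≤ 1 / (dm1 - d0) + 1 / (d1 - d0) ∧ 1 / (dm1 - d0) + 1 / (d1 - d0) ≤ 32 / 7 ∧
      (s0 ^ 2 + sm1 ^ 2) / 2 ≤ sm1 ^ 2 / (dm1 - d0) + s0 ^ 2 / (d1 - d0) ∧
      sm1 ^ 2 / (dm1 - d0) + s0 ^ 2 / (d1 - d0) ≤ 16 / 7 * (s0 ^ 2 + sm1 ^ 2) ∧
      s0 ^ 2 + sm1 ^ 2 ≤ 2 ∧ sm1 ^ 2 / (dm1 - d0) + s0 ^ 2 / (d1 - d0) ≤ 32 / 7 := by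
  have ha : 7 / 16 ≤ d1 - d0 := by linarith
  have hb : 7 / 16 ≤ dm1 - d0 := by linarith
  have ha2 : d1 - d0 ≤ 2 := by linarith
  have hb2 : dm1 - d0 ≤ 2 := by linarith
  have hapos : 0 < d1 - d0 := by linarith
  have hbpos : 0 < dm1 - d0 := by linarith
  have hs0' : s0 ^ 2 ≤ 1 := by
    have := abs_le.1 hs0; nlinarith [this.1, this.2]
  have hsm1' : sm1 ^ 2 ≤ 1 := by
    have := abs_le.1 hsm1; nlinarith [this.1, this.2]
  have i1 : 1 / 2 ≤ 1 / (d1 - d0) := one_div_le_one_div_of_le hapos ha2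
  have i2 : 1 / 2 ≤ 1 / (dm1 - d0) := one_div_le_one_div_of_le hbpos hb2
  have i3 : 1 / (d1 - d0) ≤ 16 / 7 := by rw [div_le_iff₀ hapos]; linarith
  have i4 : 1 / (dm1 - d0) ≤ 16 / 7 := by rw [div_le_iff₀ hbpos]; linarith
  have e1 : s0 ^ 2 / (d1 - d0) = s0 ^ 2 * (1 / (d1 - d0)) := by ring
  have e2 : sm1 ^ 2 / (dm1 - d0) = sm1 ^ 2 * (1 / (dm1 - d0)) := by ring
  refine ⟨by linarith, by linarith, ?_, ?_, by linarith, ?_⟩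
  · rw [e1, e2]
    nlinarith [mul_le_mul_of_nonneg_left i1 (sq_nonneg s0), mul_le_mul_of_nonneg_left i2 (sq_nonneg sm1)]
  · rw [e1, e2]
    nlinarith [mul_le_mul_of_nonneg_left i3 (sq_nonneg s0), mul_le_mul_of_nonneg_left i4 (sq_nonneg sm1)]
  · rw [e1, e2]
    nlinarith [mul_le_mul_of_nonneg_left i3 (sq_nonneg s0), mul_le_mul_of_nonneg_left i4 (sq_nonneg sm1),
      mul_le_mul i3 hs0' (sq_nonneg _) (by norm_num : (0:ℝ) ≤ 16 / 7)]

/-- **The min-polarisation gain of the cubature word is one third of the isotropic gain.** -/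
theorem minPol_slotTerm_sum (q : EuclideanSpace ℝ (Fin 3)) :
    ∑ j, (slotTerm (slots j) q 0 - slotTerm (slots j) q q) =
      1 / 3 * (c0 * 3720) * (q 0 ^ 2 + q 1 ^ 2 + q 2 ^ 2) ^ 2 := by
  rw [Finset.sum_sub_distrib, slotTerm_sum, slotTerm_sum]
  simp only [PiLp.zero_apply]
  unfold c0
  field_simp
  ring

/-- **Monotonicity of the decay form** in the constant and in the rate. -/
theorem decay_form_mono {C₁ C₂ r₁ r₂ t X : ℝ} (hC : C₁ ≤ C₂) (hC2 : 0 ≤ C₂) (hr : r₂ ≤ r₁) (ht : 0 ≤ t) (hX : 0 ≤ X) :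
    C₁ * Real.exp (-r₁ * t) * X ≤ C₂ * Real.exp (-r₂ * t) * X := by
  have h1 : Real.exp (-r₁ * t) ≤ Real.exp (-r₂ * t) := Real.exp_le_exp.2 (by nlinarith)
  have h2 : C₁ * Real.exp (-r₁ * t) ≤ C₂ * Real.exp (-r₂ * t) :=
    (mul_le_mul_of_nonneg_right hC (Real.exp_pos _).le).trans (mul_le_mul_of_nonneg_left h1 hC2)
  exact mul_le_mul_of_nonneg_right h2 hX

end Summit.AnomalousDissipation.AnomalousDissipation.Theorems.SolenoidalFractalHomogenisation.RealisedQuasiStaticCellLaw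

end
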